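import Summits.CriticalPhenomena.PercolationContinuityZ3.Theorems.PercNearOneGluingNoHeavyPcintBSMRZ7QSCert
import HarnessLib

/-!
# PCINT lane, PHASE 12 (site plane method for `d = 7`, reach-4 pieces (two-turn family), long horizon): kernel check 8/24 of the site certificate inequalities for `ℤ^7` at the cell `0.1534`

Cell `prim-pcint`, seat `prim-pcint-4` (gen 0); memo `run/shared/lean/prim/pcint/T-FIBRE-ROUTE.md` §PHASE 12.
Instance `Z7QS`: `d = 7 = 5 + 2` (`k = 5` time axes, the transverse plane), SITE percolation, 337 two-turn reach-4 pieces
(`BSMR.pc4`), 9-point law `A/DA = [1, 3, 16, 85, 790, 85, 16, 3, 1]/1000`, horizon `N = 150` in `3` chunks of `50` (window half-width `77`),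
coefficient tables exact below `M` and flat beyond (…PcintBSMRCoefFlat), Fourier tail (cut-off data, `θ₀ = 1/2`, `q₀ = 30`)
`T = 25252882/10^12`, cell `p = 1534/10^4`. One `decide +kernel` per
representative (kernel memory), bit-mask site functional `BSMR.certFastMS`.
-/

namespace Summit.CriticalPhenomena.PercolationContinuityZ3.Theorems.Pcint.BSMR.Z7QS

open Summit.CriticalPhenomena.PercolationContinuityZ3.Theorems.Pcint.BSMR Summit.CriticalPhenomena.PercolationContinuityZ3.Theorems.Pcint.BSMX Summit.CriticalPhenomena.PercolationContinuityZ3.Theorems.Pcint.BSM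

set_option maxHeartbeats 0 in
set_option maxRecDepth 65536 in
/-- The site certificate inequality at `![6, 2]` (cell `0.1534`, site `ℤ^7`). -/
theorem hrep_8a : ∀ y ∈ [(![6, 2] : Fin 2 → ℤ)], certFastMS RS 5 10000 1534 9 V0t V1t (tr2 y) (shOfV (tr2 y)) ≤ Φn y * (1534 ^ 9 * 5 * 840000000 ^ 2 * (1000000000000 * 1)) := by
  decide +kernel

set_option maxHeartbeats 0 in
set_option maxRecDepth 65536 in
/-- The site certificate inequality at `![6, 1]` (cell `0.1534`, site `ℤ^7`). -/
theorem hrep_8b : ∀ y ∈ [(![6, 1] : Fin 2 → ℤ)], certFastMS RS 5 10000 1534 9 V0t V1t (tr2 y) (shOfV (tr2 y)) ≤ Φn y * (1534 ^ 9 * 5 * 840000000 ^ 2 * (1000000000000 * 1)) := by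
  decide +kernel

set_option maxHeartbeats 0 in
set_option maxRecDepth 65536 in
/-- The site certificate inequality at `![6, 0]` (cell `0.1534`, site `ℤ^7`). -/
theorem hrep_8c : ∀ y ∈ [(![6, 0] : Fin 2 → ℤ)], certFastMS RS 5 10000 1534 9 V0t V1t (tr2 y) (shOfV (tr2 y)) ≤ Φn y * (1534 ^ 9 * 5 * 840000000 ^ 2 * (1000000000000 * 1)) := by
  decide +kernel

/-- The site certificate inequalities on the offsets `((reps8.drop 21).take 3)` (cell `0.1534`). -/
theorem hrep_8 : ∀ y ∈ ((reps8.drop 21).take 3), certFastMS RS 5 10000 1534 9 V0t V1t (tr2 y) (shOfV (tr2 y)) ≤ Φn y * (1534 ^ 9 * 5 * 840000000 ^ 2 * (1000000000000 * 1)) := by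
  intro y hy
  have hl : ((reps8.drop 21).take 3) = [(![6, 2] : Fin 2 → ℤ), (![6, 1] : Fin 2 → ℤ), (![6, 0] : Fin 2 → ℤ)] := by decide +kernel
  rw [hl] at hy
  simp only [List.mem_cons, List.not_mem_nil, or_false] at hy
  rcases hy with rfl | rfl | rfl
  · exact hrep_8a _ (List.mem_singleton.2 rfl)
  · exact hrep_8b _ (List.mem_singleton.2 rfl)
  · exact hrep_8c _ (List.mem_singleton.2 rfl)

end Summit.CriticalPhenomena.PercolationContinuityZ3.Theorems.Pcint.BSMR.Z7QS
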